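import Literature.AlgebraicGeometry.Resolution.NashBlowupToricLoopNormalized
import HarnessLib

/-!
# Barrier: iterated (normalized) Nash blowup fails to resolve singularities in dimension ≥ 4 — every
# characteristic (Castillo–Duarte–Leyton-Álvarez–Liendo 2024)

`Literature/Barriers/ResolutionOfSingularities/NashBlowupFailsDimFour.lean` — barrier catalogue entry (D-0021) for
the summit `ResolutionOfSingularities`. THIN catalogue file: the formal core is ALREADY KERNEL-CHECKED in the tree
(`Literature/AlgebraicGeometry/Resolution/NashBlowupToricLoop.lean` and `…/NashBlowupToricLoopNormalized.lean`,
namespace `Literature.AlgebraicGeometry.Resolution.CDLAL`, res-hironaka W4.4 / U1) and is only RE-EXPORTED here under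
the catalogue name with the barrier block; NO new named fact is introduced (D-0026 debt unchanged). Filed for the cell
`res-idea` (wave-2 reduction-census row R12-1, lens-12 locator; referee B batch 65 «GO as a thin catalogue file over
kernel theorems already in the tree», 2026-08-28; desk queue q36).

## What the source prints (verified on the page; held text `paper:arxiv-2409.19767`, chunk p3 L17–L30)

F. Castillo, D. Duarte, M. Leyton-Álvarez, A. Liendo, *Nash blowup fails to resolve singularities in dimensions four and
higher*, arXiv:2409.19767; Ann. of Math. (2) 203 (2026), no. 2, art. 7 [cite: CastilloEtAl2024, Theorem p. 3]. VERBATIM: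
«The aim of this paper is to disprove both the Nash blowup conjecture and the normalized Nash blowup conjecture. More
precisely, we prove the following theorem. **Theorem.** For every `d ≥ 4` and every algebraically closed field `𝕜`,
there exists a normal singular affine algebraic variety `X` of dimension `d` over `𝕜` such that: (i) If `char(𝕜) = 0`,
then the Nash blowup of `X` and the normalized Nash blowup of `X` contains an open affine subset isomorphic to `X`.
(ii) If `char(𝕜)` is positive and different from `3`, then the normalized Nash blowup of `X` contains an open affine
subset isomorphic to `X`. (iii) If `char(𝕜) = 3`, then the second iteration of the normalized Nash blowup of `X`
contains an open affine subset isomorphic to `X`. Consequently, in every dimension `d ≥ 4` and every characteristic,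
iterating the Nash blowup or the normalized Nash blowup fails to resolve singularities.» Same chunk, L30: «To prove
the theorem, we will construct explicit examples of normal singular affine toric varieties corresponding to each
case described in the theorem.» Reduction to `d = 4` by products (Lemma 1, chunk p5 L4–L8); the witness for (i) and
for (ii) with `p ∉ {2,3}` is the affine toric fourfold `X(S)`, `S = ω ∩ ℤ⁴`, `ω = cone(h₁,…,h₆)` (p. 5; the same cone
for all `p ∉ {2,3}`, p. 6 L1–2); a second cone `ω₂` for `p = 2` (p. 6 L10–41); two steps for `p = 3` (p. 6 L45 –
p. 7 L3); Remark 3 (p. 7 L4): the examples arise as charts of the (normalized) Nash blowup of a cyclic quotient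
singularity of order `5` — computer-assisted, NOT part of the theorem. The combinatorial description of the charts of
the (normalized) Nash blowup of a toric variety (González-Sprinberg; González–Teissier; Duarte–Jeffries–Núñez-Betancourt
in characteristic `p`) is recalled on p. 4 and QUOTED in the tree file's docstring; it is not formalised (no Nash
blowup, no toric geometry of this kind in Mathlib).

## Print placement of the form below (why it is WEAKER than print, never stronger)

The typed statement is the source's FINITE COMBINATORIAL CORE for `d = 4`, `p = 0` or `p ≥ 5`, exactly as the tree
files `NashBlowupToricLoop(.Normalized)` prove it: with `S = ω ∩ ℤ⁴` (`CDLAL.S`), the chart `A = {h₁,h₂,h₃,h₅}`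
(`CDLAL.chartA`, `det = −1`) and CDLAL's unimodular matrix `U` (`det U = 1`), (1) the Nash-chart semigroup
`S_A = ℕ⟨𝓗(S) ∪ 𝒢_A⟩` (generators read with `det_p` in `ZMod p`) EQUALS `U(S)` («`S_A` is isomorphic to `S` … so
`X(S_A) ≅ X(S)` is a covering chart of the Nash blow up of `X(S)`», p. 5); (2) the NORMALIZED chart semigroup at the
vertex `v_A = h₁+h₂+h₃+h₅` of the Nash polyhedron EQUALS `U(S)` too («this example also shows the theorem for normalized
Nash blowup», p. 5); (3) `U(S)` is the set of all lattice points of the cone `Uω` (saturated), so both charts are the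
NORMAL toric variety `X(U(S)) ≅ X(S)`. The scheme-level sentences (i)–(iii), «every `d ≥ 4`» (products) and «every
characteristic» (`p = 2` via `ω₂`, `p = 3` via two steps) are QUOTED above and are NOT kernel facts here; the kernel
content covers `d = 4`, `p = 0` and `p ≥ 5` only. Nothing is asserted beyond what the two tree files prove.

## Updates in print (located by lens-12 / referee B, 2026-08-28; quoted, not typed)
* Castillo–Duarte–Leyton-Álvarez–Liendo, arXiv:2511.01772, Theorem (chunk p3 L17–18): «for any field of characteristic
  zero there exists a NON-NORMAL affine algebraic variety `X` of dimension `3` such that the second iteration of the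
  Nash blowup of `X` contains an open affine subset isomorphic to `X`» ⇒ the NON-normalized Nash blowup fails already
  for `d ≥ 3` in characteristic `0` (non-normal toric threefold).
* arXiv:2511.17862, §§ 3.1–3.2 (chunk p9 L37–94) and § 4.2 (p12 L11–15): a computer census of the «Nash digraph» —
  the `𝒦₀(ℤ⁴)` loop is the only cycle found among `1.5·10⁶` vertices; «2.5 million cones of `𝒦₀(ℤ³)` … every single one
  gets resolved … we currently lack an invariant that is guaranteed to improve under the iteration of normalized Nash
  blowups … every proposed invariant has eventually been refuted by a counterexample».
* arXiv:2604.07519: a one-step normalized counterexample, `d = 5`, characteristic `3` (lens-12 locator chunk p2 L4–11).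
Open residue AS PRINTED (arXiv:2409.19767 p3 L36–44, narrowed by arXiv:2511.01772 p3 L15, L26): (A′) iterated
NON-normalized Nash blowup of SURFACES in characteristic `0`; (B) iterated normalized Nash blowup of normal THREEFOLDS
in characteristic `0` (surfaces: Spivakovsky 1990, positive); (C) normalized Nash blowup of normal surfaces and
threefolds in characteristic `p` (for toric varieties only the threefold case remains: «no counterexamples have been
found, and it seems unlikely … using toric methods»).

HONESTY. Nothing here bears on the TRUTH of resolution of singularities in dimension ≥ 4 / characteristic `p` (toric
varieties are resolved by subdividing fans); the barrier constrains one CLASS OF PROCESSES. Located ≠ adjudicated;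
the `p = 2`, `p = 3` clauses, the product reduction and the Nash-chart dictionary are QUOTED, not kernel facts.
AI-catalogued (res-idea-typ-1 g3 on referee B's batch-65 instruction), weaker than expert review.
-/

namespace Literature.Barriers.ResolutionOfSingularities

open Literature.AlgebraicGeometry.Resolution

/-! ## The formal core, re-exported from `CDLAL` under catalogue names -/

/-- The Nash-chart loop (source p. 5): for `p = 0` or `p ≥ 5` the semigroup generated by the Nash-chart generators at
`A = {h₁,h₂,h₃,h₅}` is `U(S)` — alias of `CDLAL.closure_nashChartGens_eq_map`. [cite: CastilloEtAl2024, §2 p. 5] -/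
theorem nashBlowupFailsDimFour_chart_loop (p : ℕ) (hp : p = 0 ∨ 5 ≤ p) :
    AddSubmonoid.closure (CDLAL.nashChartGens p) = CDLAL.S.map (Matrix.mulVecLin CDLAL.U) :=
  CDLAL.closure_nashChartGens_eq_map p hp

/-- The NORMALIZED Nash-chart loop at the vertex `v_A` (source p. 5, «this example also shows the theorem for normalized
Nash blowup»): for `p = 0` or `p ≥ 5` the cone generators of the Nash polyhedron at `v_A` generate `U(S)` — alias of
`CDLAL.closure_normalizedChartGens_eq_map`. [cite: CastilloEtAl2024, §2 p. 5] -/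
theorem nashBlowupFailsDimFour_normalized_loop (p : ℕ) (hp : p = 0 ∨ 5 ≤ p) :
    AddSubmonoid.closure (CDLAL.normalizedChartGens p) = CDLAL.S.map (Matrix.mulVecLin CDLAL.U) :=
  CDLAL.closure_normalizedChartGens_eq_map p hp

/-- `U(S)` is SATURATED: it is the set of all lattice points of the cone `Uω = {x : ⟨τ_j, x⟩ ≥ 0, j < 6}` — alias of
`CDLAL.mem_map_U_iff_tau`; hence the two chart semigroups above are normal and `X(U(S)) ≅ X(S)` via the lattice
automorphism `U`. [cite: CastilloEtAl2024, §2 p. 5] -/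
theorem nashBlowupFailsDimFour_saturated (m : Fin 4 → ℤ) :
    m ∈ CDLAL.S.map (Matrix.mulVecLin CDLAL.U) ↔ ∀ j : Fin 6, 0 ≤ CDLAL.tauNormal j ⬝ᵥ m :=
  CDLAL.mem_map_U_iff_tau m

/-- `U` is unimodular (`det U = 1`), so `S ↦ U(S)` is a lattice automorphism of `ℤ⁴` and `U(S) ≅ S` as semigroups —
alias of `CDLAL.det_U`. [cite: CastilloEtAl2024, §2 p. 5] -/
theorem nashBlowupFailsDimFour_det_U : CDLAL.U.det = 1 := CDLAL.det_U

/-! ## The barrier -/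

/-- **Barrier (Castillo–Duarte–Leyton-Álvarez–Liendo 2024, Main Theorem p. 3; formal core = the toric loop of §2 p. 5,
kernel-checked in the tree), in the combinatorial form.** For `p = 0` and every `p ≥ 5`: with `S = ω ∩ ℤ⁴` the
saturated semigroup of the source's cone (`CDLAL.S`) and CDLAL's unimodular `U`, BOTH the Nash-chart semigroup `S_A` at
`A = {h₁,h₂,h₃,h₅}` AND the normalized-Nash-chart semigroup at the vertex `v_A` are EQUAL to `U(S)`, which is saturated
(all lattice points of `Uω`) and isomorphic to `S` (`det U = 1`) — i.e. (through the quoted toric dictionary) the Nash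
blowup and the normalized Nash blowup of the normal singular affine toric fourfold `X(S)` contain an open affine chart
`X(U(S)) ≅ X(S)`: a FORMAL CYCLE of length one, so no iterate is ever regular. [cite: CastilloEtAl2024, Theorem p. 3 and §2 p. 5]

Technique class, in prose: resolving singularities by ITERATING the (Semple–)Nash modification `X ↦ X* =` closure of
the Gauss-map graph in `X × Grass(d,n)` — plain, or normalized (González-Sprinberg's variant) — as a STAND-ALONE,
choice-free, first-order process.

BARRIER (D-0021):
- technique_class: nash-blowup normalized-nash-blowup semple-nash-modification gauss-map-graph-closure choice-free-first-order-modification iterated-stand-alone-canonical-process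
- blocks: any proof (or algorithm) of resolution in dimension `d ≥ 4`, over an algebraically closed field of ANY characteristic, that proceeds by iterating the Nash blowup (characteristic `0`) or the normalized Nash blowup (every characteristic; two iterations for `p = 3`) alone: the source's normal toric `X` recurs as an open affine chart of its own (normalized) Nash blowup, and the Nash blowup is local on the base, so every iterate contains a chart `≅ X` and is singular [cite: CastilloEtAl2024, Theorem p. 3].
- because: FORMAL CYCLE — for the explicit cone `ω ⊂ ℝ⁴` the Nash chart `S_A` at `A = {h₁,h₂,h₃,h₅}` (`det = −1`) and the normalized chart at `v_A = (3,4,−1,−1)` both equal `U(S)` with `U ∈ GL₄(ℤ)` (`nashBlowupFailsDimFour_chart_loop`, `…_normalized_loop`, `…_saturated`, `…_det_U`; the twelve minors of display (4) and all `35` four-element minors have `|det| ≤ 3`, so `det_p = 0 ⟺ det = 0` for `p = 0`, `p ≥ 5`) [cite: CastilloEtAl2024, §2 p. 5, Lemma 2, display (4)]; `d > 4` by products with affine space (Lemma 1, p. 5); `p = 2` by a second cone `ω₂`, `p = 3` by a two-step loop (p. 6) — QUOTED.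
- evasions_known: (i) every CENTRE-based algorithm (Hironaka-style invariants and permissible centres, CJS / Cossart–Piltant in dimension ≤ 3, weighted and logarithmic blowups) and every local-ring / valuation-theoretic argument — the barrier constrains ONLY choice-free Gauss-map processes; (ii) HIGHER-ORDER Nash blowups `Nash_n` (Yasuda) are a different class, with their own suggested counterexample `z⁴ − xy` (arXiv:1803.04595 p. 11), not adjudicated here; (iii) HYBRIDS (Nash modification alternating with normalized point blowups — Hironaka 1983 / Spivakovsky's sandwiched surface singularities 1990) are not covered; (iv) dimension ≤ 3: open as printed — (A′)/(B)/(C) above — except that the NON-normalized Nash blowup fails for `d ≥ 3`, characteristic `0`, on a non-normal toric threefold (arXiv:2511.01772).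
- scope_caveats: (a) formal content = the three displayed equalities/iff for `d = 4` and `p = 0 ∨ 5 ≤ p` only (tree files `NashBlowupToricLoop`, `NashBlowupToricLoopNormalized`); (b) NOT formalised: the Nash blowup itself, the toric dictionary «charts of the (normalized) Nash blowup of `X(S)` are the `X(S_A)` / `X(S_v)`» (p. 4), the product reduction (Lemma 1), the cases `p = 2` and `p = 3`, Remark 3; (c) the computer census arXiv:2511.17862 («no improving invariant known; the `𝒦₀(ℤ⁴)` loop is the only cycle found») is evidence about the class, not part of the theorem; (d) nothing here bears on the summit's TRUTH — toric varieties are resolvable — it bears on METHOD.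
- status: established (Annals of Mathematics 203 (2026); kernel core in the tree)
-/
theorem NashBlowupFailsDimFour (p : ℕ) (hp : p = 0 ∨ 5 ≤ p) :
    AddSubmonoid.closure (CDLAL.nashChartGens p) = CDLAL.S.map (Matrix.mulVecLin CDLAL.U) ∧
      AddSubmonoid.closure (CDLAL.normalizedChartGens p) = CDLAL.S.map (Matrix.mulVecLin CDLAL.U) ∧
      (∀ m : Fin 4 → ℤ, m ∈ CDLAL.S.map (Matrix.mulVecLin CDLAL.U) ↔ ∀ j : Fin 6, 0 ≤ CDLAL.tauNormal j ⬝ᵥ m) ∧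
      CDLAL.U.det = 1 :=
  ⟨nashBlowupFailsDimFour_chart_loop p hp, nashBlowupFailsDimFour_normalized_loop p hp,
    nashBlowupFailsDimFour_saturated, nashBlowupFailsDimFour_det_U⟩

end Literature.Barriers.ResolutionOfSingularities
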